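import Summits.QuantumFields.YangMills.Theorems.LuscherReductionTwistedTraceScalingBOAssemblyFloor
import Summits.QuantumFields.YangMills.Theorems.LuscherReductionRunningReductionCoarseUpperPrelim
import Summits.QuantumFields.YangMills.Theorems.LuscherReductionOneSiteLevelsVariational
import HarnessLib

/-!
# The LEVEL-`k` doors of the floor: a family Courant–Fischer door, and the tube floor glue for a `(k+1)`-family of tube functions
# (lane A of S-BASE, crux `TwistedTraceScaling` stmt-QuantumFields-20203, line «twolattice», stub `stub_fixedLatticeTraceLaw`; second half (F_k) of BO_lower(L) ∕ COARSE-LOWER(L);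
# lead g23; `HANDOFF-g23.md`)

The level-`k` floor `e^{−ελ_b}·σ·μ_k(L³β) ≤ λ_k(β, L)` is a LOWER bound on the `k`-th zero-flux transfer value, obtained from a `(k+1)`-dimensional space of trial functions by the
Courant–Fischer lower-bound principle ✓`le_levelValue_of_subspace`.  This file supplies the two doors, the level-`k` twins of the `k = 0` glue ✓`tubeForm_le_levelValue_zero`
(`…TubeFloorGlue`):
* §1 `gaugeAvg_sum_mul` — the gauge average is linear on bounded measurable functions (`gaugeAvg (Σ aᵢfᵢ) = Σ aᵢ gaugeAvg fᵢ`);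
* §2 ★ `le_levelValue_of_family` — FAMILY COURANT–FISCHER DOOR: physical `Ψ₀ … Ψ_k` with `‖Σaᵢ Ψᵢ‖² > 0` for `a ≠ 0` and `s‖Σaᵢ Ψᵢ‖² ≤ ⟨Σaᵢ Ψᵢ, K_β Σaᵢ Ψᵢ⟩` for all `a`
  give `s ≤ λ_k(β, L)` (✓`le_levelValue_of_subspace` on the range of `Fintype.linearCombination ℝ Ψ`, injective by nondegeneracy);
* §3 ★★ `le_levelValue_of_tube_family` — TUBE FLOOR GLUE AT LEVEL `k`: bounded measurable tube functions `f₀ … f_k` vanishing off `supp χ` and off `{orbitDist < δ}`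
  (`L(δ+m) < 2`), with `s·‖f_a‖²_{N/χ} ≤ T(f_a)` (`s ≥ 0`) and `T(f_a) > 0` for every non-zero combination `f_a = Σ aᵢfᵢ`, give `s − 7·crossBound L β m ≤ λ_k(β, L)`
  (trial family `twistSum (gaugeAvg fᵢ)`: ✓`qform_gaugeAvg_eq_tubeForm`, ✓`l2_gaugeAvg_le_tubeNormSq`, ✓`l2_twistSum`, ✓`abs_qform_twistSum_sub_le`; nondegeneracy from `T(f_a) > 0`
  through ✓`qform_eq_zero_of_l2_eq_zero`).
HONEST FRAMING: variational bookkeeping at fixed `β`; the floor itself needs the localised level-`k` family (✓`exists_localized_near_level`) and the bricks; (F_k), BO_lower(L),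
COARSE-LOWER(L), `stub_cmpTwoLoop` and the crux stay OPEN; CONDITIONAL route R2b1; not a gap, not Clay.  No named facts, no `sorry`.
-/

set_option autoImplicit false

noncomputable section

open MeasureTheory Filter Topology Real
open scoped BigOperators
open Literature.MathematicalPhysics.QuantumFieldTheory
open Literature.MathematicalPhysics.QuantumLattice

namespace Summit.QuantumFields.YangMills.Theorems.FemtoTransferGap.TwoLattice.ConstTube

open Summit.QuantumFields.YangMills.Theorems.FemtoTransferGap
open Summit.QuantumFields.YangMills.Theorems.FemtoTransferGap.TwoLattice.Avg

variable {L : ℕ} [NeZero L]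

/-! ## §1 Linearity of the gauge average -/

/-- `gaugeAvg (Σ aᵢ fᵢ) = Σ aᵢ·gaugeAvg fᵢ` for bounded measurable `fᵢ`. [folklore] -/
theorem gaugeAvg_sum_mul {k : ℕ} (a : Fin (k + 1) → ℝ) {f : Fin (k + 1) → GaugeConfig 3 L SU2 → ℝ} (hf : ∀ i, Measurable (f i))
    (hb : ∀ i, ∃ C : ℝ, ∀ U, |f i U| ≤ C) :
    gaugeAvg (fun U => ∑ i, a i * f i U) = fun V => ∑ i, a i * gaugeAvg (f i) V := by
  funext V
  unfold gaugeAvg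
  rw [integral_finsetSum _ fun i _ => ?_]
  · exact Finset.sum_congr rfl fun i _ => integral_const_mul _ _
  · obtain ⟨C, hC⟩ := hb i
    exact (integrable_of_measurable_abs_le _ (measurable_comp_gaugeTransform_left (hf i) V) fun g => hC _).const_mul (a i)

/-! ## §2 ★ The family Courant–Fischer door -/

/-- ★ **FAMILY COURANT–FISCHER DOOR**: physical `Ψ₀, …, Ψ_k` whose non-zero combinations have `‖Σaᵢ Ψᵢ‖² > 0`, and `s‖Σaᵢ Ψᵢ‖² ≤ ⟨Σaᵢ Ψᵢ, K_β Σaᵢ Ψᵢ⟩` for every `a`, give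
`s ≤ λ_k(β, L)`. [cite: ReedSimonIV1978, Thm. XIII.1] -/
theorem le_levelValue_of_family {β : ℝ} {k : ℕ} (Ψ : Fin (k + 1) → GaugeConfig 3 L SU2 → ℝ) (hphys : ∀ i, IsPhys (Ψ i)) {s : ℝ}
    (hnd : ∀ a : Fin (k + 1) → ℝ, a ≠ 0 → 0 < l2 (fun U => ∑ i, a i * Ψ i U) (fun U => ∑ i, a i * Ψ i U))
    (hs : ∀ a : Fin (k + 1) → ℝ, s * l2 (fun U => ∑ i, a i * Ψ i U) (fun U => ∑ i, a i * Ψ i U) ≤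
      qform su2Rep β (fun U => ∑ i, a i * Ψ i U) (fun U => ∑ i, a i * Ψ i U)) :
    s ≤ levelValue su2Rep L β k := by
  set T : (Fin (k + 1) → ℝ) →ₗ[ℝ] (GaugeConfig 3 L SU2 → ℝ) := Fintype.linearCombination ℝ Ψ with hTdef
  have hT : ∀ a, T a = fun U => ∑ i, a i * Ψ i U := fun a => by
    rw [hTdef, Fintype.linearCombination_apply]
    funext U
    simp [Finset.sum_apply, smul_eq_mul]
  have hinj : Function.Injective T := by
    intro a b hab
    by_contra hne
    have hpos := hnd (a - b) (sub_ne_zero.mpr hne)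
    have h0 : T (a - b) = 0 := by rw [map_sub, hab, sub_self]
    rw [hT] at h0
    rw [h0] at hpos
    simp [l2] at hpos
  set W : Submodule ℝ (GaugeConfig 3 L SU2 → ℝ) := LinearMap.range T with hWdef
  have hW : Module.finrank ℝ W = k + 1 := by rw [hWdef, LinearMap.finrank_range_of_inj hinj, Module.finrank_fin_fun]
  refine le_levelValue_of_subspace su2Rep continuous_su2Rep β W hW ?_ ?_ ?_
  · rintro ψ ⟨a, rfl⟩
    rw [hT]; exact isPhys_sum_mul_lat Finset.univ Ψ hphys a
  · rintro ψ ⟨a, rfl⟩ hne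
    have ha : a ≠ 0 := by rintro rfl; exact hne (map_zero T)
    rw [hT]; exact hnd a ha
  · rintro ψ ⟨a, rfl⟩
    rw [hT]; exact hs a

/-! ## §3 ★★ The tube floor glue at level `k` -/

set_option maxHeartbeats 400000 in
/-- ★★ **TUBE FLOOR GLUE AT LEVEL `k`**: for `β ≥ 0`, `m ≥ 0`, `L(δ+m) < 2`, `χ ≥ 0` bounded measurable with `χ ≥ c > 0` on its support, and bounded measurable tube functions
`f₀, …, f_k` vanishing off `supp χ` and off `{orbitDist < δ}`: if `s·‖f_a‖²_{N/χ} ≤ T(f_a)` for every combination `f_a = Σ aᵢfᵢ` (`s ≥ 0`) and `T(f_a) > 0` for `a ≠ 0`, then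
`s − 7·crossBound L β m ≤ λ_k(β, L)`. [cite: Luscher1983, §3] [cite: ReedSimonIV1978, Thm. XIII.1] -/
theorem le_levelValue_of_tube_family {β : ℝ} (hβ : 0 ≤ β) {δ m : ℝ} (hm : 0 ≤ m) (hLδm : (L : ℝ) * (δ + m) < 2)
    {χ : GaugeConfig 3 L SU2 → ℝ} (hχ : Measurable χ) {Cχ : ℝ} (hCχ : ∀ U, |χ U| ≤ Cχ) (hχ0 : ∀ U, 0 ≤ χ U) {c : ℝ} (hc : 0 < c)
    (hcχ : ∀ U, χ U ≠ 0 → c ≤ χ U) {k : ℕ} {f : Fin (k + 1) → GaugeConfig 3 L SU2 → ℝ} (hf : ∀ i, Measurable (f i))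
    (hfb : ∀ i, ∃ C : ℝ, ∀ U, |f i U| ≤ C) (hsupp : ∀ i U, χ U = 0 → f i U = 0) (hsuppδ : ∀ i U, f i U ≠ 0 → orbitDist U < δ)
    {s : ℝ} (hs0 : 0 ≤ s)
    (hs : ∀ a : Fin (k + 1) → ℝ, s * tubeNormSq (softWeight χ) (fun U => ∑ i, a i * f i U) ≤ tubeForm β (fun U => ∑ i, a i * f i U))
    (hpos : ∀ a : Fin (k + 1) → ℝ, a ≠ 0 → 0 < tubeForm β (fun U => ∑ i, a i * f i U)) :
    s - 7 * crossBound L β m ≤ levelValue su2Rep L β k := by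
  have hLδ : (L : ℝ) * δ < 2 := by have hL0 : (0 : ℝ) ≤ L := Nat.cast_nonneg L; nlinarith
  have hcB0 : 0 ≤ crossBound L β m := (crossBound_pos β m).le
  -- the physical family
  have hΨphys : ∀ i, IsPhys (twistSum (gaugeAvg (f i))) := fun i => by
    obtain ⟨C, hC⟩ := hfb i
    exact isPhys_twistSum (measurable_gaugeAvg (hf i)) ⟨C, abs_gaugeAvg_le (hf i) hC⟩ (fun g U => gaugeAvg_gaugeTransform (f i) g U)
  have hcomb : ∀ a : Fin (k + 1) → ℝ, (fun U => ∑ i, a i * twistSum (gaugeAvg (f i)) U) = twistSum (gaugeAvg (fun U => ∑ i, a i * f i U)) :=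
    fun a => by rw [gaugeAvg_sum_mul a hf hfb, twistSum_sum_mul]
  -- the Rayleigh bound and nondegeneracy on each combination
  have key : ∀ a : Fin (k + 1) → ℝ,
      (a ≠ 0 → 0 < l2 (twistSum (gaugeAvg (fun U => ∑ i, a i * f i U))) (twistSum (gaugeAvg (fun U => ∑ i, a i * f i U)))) ∧
      (s - 7 * crossBound L β m) * l2 (twistSum (gaugeAvg (fun U => ∑ i, a i * f i U))) (twistSum (gaugeAvg (fun U => ∑ i, a i * f i U))) ≤
        qform su2Rep β (twistSum (gaugeAvg (fun U => ∑ i, a i * f i U))) (twistSum (gaugeAvg (fun U => ∑ i, a i * f i U))) := by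
    intro a
    set fa : GaugeConfig 3 L SU2 → ℝ := fun U => ∑ i, a i * f i U with hfadef
    -- data of `fa`
    have hfam : Measurable fa := Finset.measurable_sum _ fun i _ => measurable_const.mul (hf i)
    choose C hC using hfb
    have hCf : ∀ U, |fa U| ≤ ∑ i, |a i| * C i := fun U => by
      calc |fa U| = |∑ i, a i * f i U| := rfl
        _ ≤ ∑ i, |a i * f i U| := Finset.abs_sum_le_sum_abs _ _
        _ ≤ ∑ i, |a i| * C i := Finset.sum_le_sum fun i _ => by rw [abs_mul]; exact mul_le_mul_of_nonneg_left (hC i U) (abs_nonneg _)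
    have hfχ : ∀ U, χ U = 0 → fa U = 0 := fun U hU => by
      show ∑ i, a i * f i U = 0
      exact Finset.sum_eq_zero fun i _ => by rw [hsupp i U hU, mul_zero]
    have hfδ : ∀ U, fa U ≠ 0 → orbitDist U < δ := fun U hU => by
      obtain ⟨i, -, hi⟩ := Finset.exists_ne_zero_of_sum_ne_zero hU
      exact hsuppδ i U (right_ne_zero_of_mul hi)
    -- the gauge average and its twist symmetrisation
    set ψ : GaugeConfig 3 L SU2 → ℝ := gaugeAvg fa with hψdef
    have hψm : Measurable ψ := measurable_gaugeAvg hfam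
    have hψb : ∀ U, |ψ U| ≤ ∑ i, |a i| * C i := abs_gaugeAvg_le hfam hCf
    have hψs : ∀ U, ψ U ≠ 0 → orbitDist U < δ := fun U hU => orbitDist_lt_of_gaugeAvg_ne_zero hfδ hU
    have hphys : IsPhys (twistSum ψ) :=
      isPhys_twistSum hψm ⟨_, hψb⟩ fun g U => gaugeAvg_gaugeTransform fa g U
    have hn : l2 (twistSum ψ) (twistSum ψ) = 8 * l2 ψ ψ := l2_twistSum hψm hψb hLδ hψs
    have hq := abs_qform_twistSum_sub_le hβ hψm hψb hm hLδm hψs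
    rw [abs_le] at hq
    have hn0 : 0 ≤ l2 ψ ψ := l2_self_nonneg_lat _
    have hT : tubeForm β fa = qform su2Rep β ψ ψ := (qform_gaugeAvg_eq_tubeForm β hfam hCf).symm
    have hnorm : l2 ψ ψ ≤ tubeNormSq (softWeight χ) fa := l2_gaugeAvg_le_tubeNormSq hfam hCf hχ hCχ hχ0 hc hcχ hfχ
    have h8 : 8 * tubeForm β fa - 56 * (crossBound L β m * l2 ψ ψ) ≤ qform su2Rep β (twistSum ψ) (twistSum ψ) := by
      rw [hT]; linarith [hq.1]
    have h1 : s * l2 ψ ψ ≤ tubeForm β fa := (mul_le_mul_of_nonneg_left hnorm hs0).trans (hs a)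
    refine ⟨fun ha => ?_, ?_⟩
    · by_contra hnot
      have hz : l2 (twistSum ψ) (twistSum ψ) = 0 := le_antisymm (not_lt.mp hnot) (l2_self_nonneg_lat _)
      have hq0 := qform_eq_zero_of_l2_eq_zero β hphys hz
      have hl0 : l2 ψ ψ = 0 := by linarith [hn]
      have hp := hpos a ha
      rw [hq0, hl0] at h8
      linarith
    · rw [hn]
      nlinarith [h8, h1, hn0, hcB0]
  refine le_levelValue_of_family (fun i => twistSum (gaugeAvg (f i))) hΨphys (fun a ha => ?_) (fun a => ?_)
  · have h := (key a).1 ha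
    rw [← hcomb a] at h; exact h
  · have h := (key a).2
    rw [← hcomb a] at h; exact h

end Summit.QuantumFields.YangMills.Theorems.FemtoTransferGap.TwoLattice.ConstTube

end
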